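import Mathlib
import HarnessLib

/-!
# Theta bodies of a polynomial ideal (Gouveia–Thomas)

[cite: BlekhermanParriloThomas2012, Ch. 7 (J. Gouveia and R. R. Thomas, *Convex hulls of
algebraic sets*), §7.2 pp. 296–305: eq. (7.1), the definition of `TH_k(I)` and the hierarchy
display (p. 297), §7.2.1 (sums of squares modulo an ideal; Example 7.1), §7.2.2 up to
Theorem 7.6]

Let `I ⊆ ℝ[x]` be an ideal with real variety `V_ℝ(I)` (Mathlib's `MvPolynomial.zeroLocus ℝ I`).
A polynomial `f` is *sos mod `I`* if `f ≡ ∑ h_j² (mod I)`, and *`k`-sos mod `I`* if moreover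
every `h_j` lies in `ℝ[x]_k` (§7.2 (ii), p. 296; §7.2.1, p. 298).  The *`k`-th theta body* of
`I` is (p. 297)

  `TH_k(I) := {x ∈ ℝⁿ : l(x) ≥ 0 for all l linear and k-sos mod I}`,

where, as on p. 304, a linear (affine) polynomial `α + ⟨a, x⟩ ∈ ℝ[x]₁` is identified with the
vector `(α, a) ∈ ℝ × ℝⁿ` (`affinePoly α a`).  We record the printed facts:

* (7.1): a polynomial that is sos mod `I` is nonnegative on `V_ℝ(I)` (`IsSosMod.eval_nonneg`);
* `TH_k(I)` is closed and convex, contains `V_ℝ(I)` and hence `cl(conv(V_ℝ(I)))`, and the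
  theta bodies form the hierarchy `TH_1(I) ⊇ TH_2(I) ⊇ ⋯ ⊇ cl(conv(V_ℝ(I)))` (p. 297);
* the `k`-sos classes form a convex cone containing the nonnegative constants (pp. 304–305),
  and `x ≡ x²` is `1`-sos modulo `⟨x − x²⟩` (p. 298);
* Definition 7.25 (§7.3: convergence of the theta body sequence, `TH_k`-exactness);
* the elementary inclusion `Q_k(I) ⊆ TH_k(I)` behind Theorem 7.6 (`TH_k(I) = cl(Q_k(I))`):
  a linear functional `L` vanishing on `I`, nonnegative on `k`-sos polynomials and with
  `L(1) = 1` gives the point `(L(x_1), …, L(x_n)) ∈ TH_k(I)` (`mem_thetaBody_of_functional`);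
* Example 7.1 (the lemniscate `f = x⁴ + y⁴ + 2x²y² − x² + y²`): Reznick's exact certificate
  `(1/√8 − y) + (1/√2)·f = (1/(4√2))(2x² + 2y² − 1)² + √2 (y − 1/√8)²` shows that the
  bitangent functional `1/√8 − y` is `2`-sos mod `⟨f⟩`, so `TH₂(⟨f⟩)` lies in the half-plane
  `y ≤ 1/√8` (pp. 299–301).

Not formalised here: the reverse inclusion of Theorem 7.6 (Lemmas 7.4–7.5), Theorem 7.8 and
the θ-basis / combinatorial moment matrix representation (Definition 7.3 ff.).
-/

noncomputable section

open MvPolynomial Finset Matrix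

namespace Literature.Algebra.Polynomial.ThetaBodies

variable {σ : Type*} {I : Ideal (MvPolynomial σ ℝ)} {k : ℕ} {f g : MvPolynomial σ ℝ}

/-! ### Sums of squares modulo an ideal (§7.2.1) -/

/-- `f` is *sos mod `I`*: `f ≡ ∑_j h_j² (mod I)` for finitely many polynomials `h_j`.
[cite: BlekhermanParriloThomas2012, Ch. 7 §7.2.1, p. 298] -/
def IsSosMod (I : Ideal (MvPolynomial σ ℝ)) (f : MvPolynomial σ ℝ) : Prop :=
  ∃ (m : ℕ) (h : Fin m → MvPolynomial σ ℝ), f - ∑ j, h j ^ 2 ∈ I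

/-- `f` is *`k`-sos mod `I`*: `f ≡ ∑_j h_j² (mod I)` with every `h_j ∈ ℝ[x]_k`, i.e. the class
`f + I` lies in `Σ_{2k}/I`.
[cite: BlekhermanParriloThomas2012, Ch. 7 §7.2 (ii) p. 296 and §7.2.1 p. 298] -/
def IsKSosMod (I : Ideal (MvPolynomial σ ℝ)) (k : ℕ) (f : MvPolynomial σ ℝ) : Prop :=
  ∃ (m : ℕ) (h : Fin m → MvPolynomial σ ℝ), (∀ j, (h j).totalDegree ≤ k) ∧ f - ∑ j, h j ^ 2 ∈ I

/-- `k`-sos mod `I` implies sos mod `I`.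
[cite: BlekhermanParriloThomas2012, Ch. 7 §7.2.1, p. 298] -/
theorem IsKSosMod.isSosMod (hf : IsKSosMod I k f) : IsSosMod I f := by
  obtain ⟨m, h, -, hmem⟩ := hf
  exact ⟨m, h, hmem⟩

/-- `k`-sos mod `I` implies `l`-sos mod `I` for `k ≤ l` (`Σ_{2k} ⊆ Σ_{2l}`): the source of the
chain `TH_1(I) ⊇ TH_2(I) ⊇ ⋯`. [cite: BlekhermanParriloThomas2012, Ch. 7 §7.2, p. 297] -/
theorem IsKSosMod.mono {l : ℕ} (hkl : k ≤ l) (hf : IsKSosMod I k f) : IsKSosMod I l f := by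
  obtain ⟨m, h, hdeg, hmem⟩ := hf
  exact ⟨m, h, fun j => (hdeg j).trans hkl, hmem⟩

/-- Being `k`-sos mod `I` only depends on the class `f + I` in `ℝ[x]/I`.
[cite: BlekhermanParriloThomas2012, Ch. 7 §7.2.1, p. 298 (`Σ_{2k}/I`)] -/
theorem IsKSosMod.congr (hfg : f - g ∈ I) (hg : IsKSosMod I k g) : IsKSosMod I k f := by
  obtain ⟨m, h, hdeg, hmem⟩ := hg
  refine ⟨m, h, hdeg, ?_⟩
  have := I.add_mem hfg hmem
  rwa [sub_add_sub_cancel] at this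

/-- A certificate `f = ∑_j h_j² + p` with `deg h_j ≤ k` and `p ∈ I` ((7.1) with `σ ∈ Σ_{2k}`,
method (ii)) shows that `f` is `k`-sos mod `I`; in particular "`k`-sos mod `{f_1, …, f_m}`"
(method (i)) implies "`k`-sos mod `I`".
[cite: BlekhermanParriloThomas2012, Ch. 7 §7.2, (7.1) and (i)–(ii), p. 296] -/
theorem isKSosMod_of_eq {m : ℕ} (h : Fin m → MvPolynomial σ ℝ)
    (hdeg : ∀ j, (h j).totalDegree ≤ k) {p : MvPolynomial σ ℝ} (hp : p ∈ I)
    (hf : f = ∑ j, h j ^ 2 + p) : IsKSosMod I k f :=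
  ⟨m, h, hdeg, by rwa [hf, add_sub_cancel_left]⟩

/-- `isKSosMod_of_eq` for a family of squares indexed by an arbitrary finite type.
[cite: BlekhermanParriloThomas2012, Ch. 7 §7.2, (7.1) and (ii), p. 296] -/
theorem isKSosMod_of_eq' {ι : Type*} [Fintype ι] (h : ι → MvPolynomial σ ℝ)
    (hdeg : ∀ i, (h i).totalDegree ≤ k) {p : MvPolynomial σ ℝ} (hp : p ∈ I)
    (hf : f = ∑ i, h i ^ 2 + p) : IsKSosMod I k f :=
  isKSosMod_of_eq (h ∘ (Fintype.equivFin ι).symm) (fun _ => hdeg _) hp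
    (hf.trans (by
      rw [Fintype.sum_equiv (Fintype.equivFin ι) (fun i => h i ^ 2)
        (fun j => ((h ∘ (Fintype.equivFin ι).symm) j) ^ 2) fun i => by simp]))

/-- Sums of squares of polynomials of degree `≤ k` are `k`-sos mod every ideal (`Σ_{2k}/I`).
[cite: BlekhermanParriloThomas2012, Ch. 7 §7.2.1, p. 298] -/
theorem isKSosMod_sum_sq {m : ℕ} (h : Fin m → MvPolynomial σ ℝ)
    (hdeg : ∀ j, (h j).totalDegree ≤ k) : IsKSosMod I k (∑ j, h j ^ 2) :=
  ⟨m, h, hdeg, by rw [sub_self]; exact I.zero_mem⟩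

/-- Nonnegative constants are `k`-sos mod `I` (e.g. "the constant polynomial `1` lies in
`Σ₁ᵏ(I)`", proof of Lemma 7.4).
[cite: BlekhermanParriloThomas2012, Ch. 7 §7.2.2, proof of Lemma 7.4, p. 305] -/
theorem isKSosMod_C {c : ℝ} (hc : 0 ≤ c) : IsKSosMod I k (C c) := by
  refine ⟨1, fun _ => C (Real.sqrt c), fun _ => by rw [totalDegree_C]; exact Nat.zero_le _, ?_⟩
  rw [Fin.sum_univ_one, ← map_pow, Real.sq_sqrt hc, sub_self]
  exact I.zero_mem

/-- The constant `1` is `k`-sos mod `I`.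
[cite: BlekhermanParriloThomas2012, Ch. 7 §7.2.2, proof of Lemma 7.4, p. 305] -/
theorem isKSosMod_one : IsKSosMod I k 1 := by
  simpa using isKSosMod_C (I := I) (k := k) zero_le_one

/-- The `k`-sos classes are closed under addition (`Σᵏ(I) = Σ_{2k}/I` is a cone).
[cite: BlekhermanParriloThomas2012, Ch. 7 §7.2.2, p. 304–305] -/
theorem IsKSosMod.add (hf : IsKSosMod I k f) (hg : IsKSosMod I k g) :
    IsKSosMod I k (f + g) := by
  obtain ⟨m, h, hdeg, hmem⟩ := hf
  obtain ⟨m', h', hdeg', hmem'⟩ := hg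
  refine ⟨m + m', Fin.append h h', fun j => ?_, ?_⟩
  · induction j using Fin.addCases with
    | left i => rw [Fin.append_left]; exact hdeg i
    | right i => rw [Fin.append_right]; exact hdeg' i
  · rw [Fin.sum_univ_add]
    simp only [Fin.append_left, Fin.append_right]
    have e : f + g - (∑ i : Fin m, h i ^ 2 + ∑ i : Fin m', h' i ^ 2) =
        (f - ∑ i, h i ^ 2) + (g - ∑ i, h' i ^ 2) := by ring
    rw [e]
    exact I.add_mem hmem hmem'

/-- The `k`-sos classes are closed under nonnegative scalings (`Σᵏ(I)` is a cone).
[cite: BlekhermanParriloThomas2012, Ch. 7 §7.2.2, p. 304–305] -/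
theorem IsKSosMod.smul {c : ℝ} (hc : 0 ≤ c) (hf : IsKSosMod I k f) :
    IsKSosMod I k (c • f) := by
  obtain ⟨m, h, hdeg, hmem⟩ := hf
  refine ⟨m, fun j => Real.sqrt c • h j,
    fun j => (totalDegree_smul_le _ _).trans (hdeg j), ?_⟩
  have e : ∑ j, (Real.sqrt c • h j) ^ 2 = c • ∑ j, h j ^ 2 := by
    rw [Finset.smul_sum]
    refine Finset.sum_congr rfl fun j _ => ?_
    rw [smul_pow, Real.sq_sqrt hc]
  rw [e, ← smul_sub, smul_eq_C_mul]
  exact I.mul_mem_left _ hmem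

/-- Finite sums of `k`-sos classes are `k`-sos (`Σᵏ(I)` is a convex cone).
[cite: BlekhermanParriloThomas2012, Ch. 7 §7.2.2, p. 304–305] -/
theorem IsKSosMod.sum {ι : Type*} (s : Finset ι) {F : ι → MvPolynomial σ ℝ}
    (hF : ∀ i ∈ s, IsKSosMod I k (F i)) : IsKSosMod I k (∑ i ∈ s, F i) := by
  classical
  induction s using Finset.induction_on with
  | empty => simpa using isKSosMod_C (I := I) (k := k) le_rfl
  | insert a s ha ih =>
    rw [Finset.sum_insert ha]
    exact (hF a (Finset.mem_insert_self a s)).add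
      (ih fun i hi => hF i (Finset.mem_insert_of_mem hi))

/-- "The univariate linear polynomial `x` is congruent to `x²` mod `⟨x − x²⟩`": `x_i` is `1`-sos
modulo `⟨x_i − x_i²⟩`. [cite: BlekhermanParriloThomas2012, Ch. 7 §7.2.1, p. 298] -/
theorem isKSosMod_one_X (i : σ) :
    IsKSosMod (Ideal.span {(X i - X i ^ 2 : MvPolynomial σ ℝ)}) 1 (X i) :=
  ⟨1, fun _ => X i, fun _ => (totalDegree_X (R := ℝ) i).le, by
    rw [Fin.sum_univ_one]; exact Ideal.subset_span rfl⟩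

/-- **(7.1)**: a polynomial that is sos mod `I` is nonnegative on the real variety `V_ℝ(I)`:
for `s ∈ V_ℝ(I)`, `f(s) = ∑_j h_j(s)² ≥ 0`.
[cite: BlekhermanParriloThomas2012, Ch. 7 §7.2, (7.1), p. 296] -/
theorem IsSosMod.eval_nonneg (hf : IsSosMod I f) {x : σ → ℝ} (hx : x ∈ zeroLocus ℝ I) :
    0 ≤ eval x f := by
  obtain ⟨m, h, hmem⟩ := hf
  have h0 : aeval x (f - ∑ j, h j ^ 2) = 0 := hx _ hmem
  rw [aeval_eq_eval, map_sub, sub_eq_zero] at h0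
  rw [h0, map_sum]
  exact Finset.sum_nonneg fun j _ => by rw [map_pow]; exact sq_nonneg _

/-- A `k`-sos polynomial mod `I` is nonnegative on `V_ℝ(I)`.
[cite: BlekhermanParriloThomas2012, Ch. 7 §7.2, (7.1), p. 296] -/
theorem IsKSosMod.eval_nonneg (hf : IsKSosMod I k f) {x : σ → ℝ} (hx : x ∈ zeroLocus ℝ I) :
    0 ≤ eval x f :=
  hf.isSosMod.eval_nonneg hx

/-! ### Theta bodies (§7.2, p. 297; §7.2.2) -/

section ThetaBody

variable [Fintype σ]

/-- The linear (affine) polynomial `α + ⟨a, x⟩ ∈ ℝ[x]₁`, identified with `(α, a) ∈ ℝ × ℝⁿ`.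
[cite: BlekhermanParriloThomas2012, Ch. 7 §7.2.2, p. 304] -/
def affinePoly (α : ℝ) (a : σ → ℝ) : MvPolynomial σ ℝ := C α + ∑ i, C (a i) * X i

/-- `(α + ⟨a, ·⟩)(x) = α + ⟨a, x⟩`. [cite: BlekhermanParriloThomas2012, Ch. 7 §7.2.2, p. 304] -/
@[simp] theorem eval_affinePoly (α : ℝ) (a : σ → ℝ) (x : σ → ℝ) :
    eval x (affinePoly α a) = α + a ⬝ᵥ x := by
  simp [affinePoly, dotProduct, map_sum]

/-- Affine polynomials lie in `ℝ[x]₁`. [cite: BlekhermanParriloThomas2012, Ch. 7 §7.2.2, p. 304] -/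
theorem totalDegree_affinePoly_le (α : ℝ) (a : σ → ℝ) : (affinePoly α a).totalDegree ≤ 1 := by
  refine (totalDegree_add _ _).trans (max_le ?_ ?_)
  · rw [totalDegree_C]; exact zero_le_one
  refine (totalDegree_finsetSum _ _).trans (Finset.sup_le fun i _ => ?_)
  refine (totalDegree_mul _ _).trans ?_
  rw [totalDegree_C, zero_add]
  exact (totalDegree_X (R := ℝ) i).le

/-- The `k`-th **theta body** of the ideal `I`:
`TH_k(I) := {x ∈ ℝⁿ : l(x) ≥ 0 for every linear l that is k-sos mod I}`.
[cite: BlekhermanParriloThomas2012, Ch. 7 §7.2, p. 297; §7.2.2, p. 303] -/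
def thetaBody (I : Ideal (MvPolynomial σ ℝ)) (k : ℕ) : Set (σ → ℝ) :=
  {x | ∀ (α : ℝ) (a : σ → ℝ), IsKSosMod I k (affinePoly α a) → 0 ≤ α + a ⬝ᵥ x}

/-- Membership in `TH_k(I)`. [cite: BlekhermanParriloThomas2012, Ch. 7 §7.2, p. 297] -/
theorem mem_thetaBody_iff {x : σ → ℝ} : x ∈ thetaBody I k ↔
    ∀ (α : ℝ) (a : σ → ℝ), IsKSosMod I k (affinePoly α a) → 0 ≤ α + a ⬝ᵥ x :=
  Iff.rfl

/-- `V_ℝ(I) ⊆ TH_k(I)` ("Clearly `V_ℝ(I)` … is contained in `TH_k(I)` for all `k`").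
[cite: BlekhermanParriloThomas2012, Ch. 7 §7.2, p. 297] -/
theorem zeroLocus_subset_thetaBody : zeroLocus ℝ I ⊆ thetaBody I k :=
  fun x hx α a hl => by
    rw [← eval_affinePoly]
    exact hl.eval_nonneg hx

/-- The hierarchy `TH_k(I) ⊇ TH_l(I)` for `k ≤ l`.
[cite: BlekhermanParriloThomas2012, Ch. 7 §7.2, hierarchy display, p. 297] -/
theorem thetaBody_antitone {l : ℕ} (hkl : k ≤ l) : thetaBody I l ⊆ thetaBody I k :=
  fun _ hx α a hl => hx α a (hl.mono hkl)

/-- `TH_k(I) ⊇ TH_{k+1}(I)`. [cite: BlekhermanParriloThomas2012, Ch. 7 §7.2, p. 297] -/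
theorem thetaBody_succ_subset : thetaBody I (k + 1) ⊆ thetaBody I k :=
  thetaBody_antitone k.le_succ

/-- `TH_k(I)` is the intersection of the half-spaces `{x : l(x) ≥ 0}`, `l` linear and `k`-sos
mod `I`. [cite: BlekhermanParriloThomas2012, Ch. 7 §7.2, pp. 296–297] -/
theorem thetaBody_eq_iInter : thetaBody I k =
    ⋂ (α : ℝ) (a : σ → ℝ) (_ : IsKSosMod I k (affinePoly α a)), {x | 0 ≤ α + a ⬝ᵥ x} := by
  ext x
  simp only [thetaBody, Set.mem_setOf_eq, Set.mem_iInter]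

/-- `TH_k(I)` is closed. [cite: BlekhermanParriloThomas2012, Ch. 7 §7.2, p. 297] -/
theorem isClosed_thetaBody : IsClosed (thetaBody I k) := by
  rw [thetaBody_eq_iInter]
  refine isClosed_iInter fun α => isClosed_iInter fun a => isClosed_iInter fun _ => ?_
  exact isClosed_le continuous_const
    (continuous_const.add (continuous_const.dotProduct continuous_id))

/-- `TH_k(I)` is convex. [cite: BlekhermanParriloThomas2012, Ch. 7 §7.2, p. 297] -/
theorem convex_thetaBody : Convex ℝ (thetaBody I k) := by
  rw [thetaBody_eq_iInter]
  refine convex_iInter fun α => convex_iInter fun a => convex_iInter fun _ => ?_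
  intro x hx y hy u v hu hv huv
  simp only [Set.mem_setOf_eq] at hx hy ⊢
  have e : α + a ⬝ᵥ (u • x + v • y) = u * (α + a ⬝ᵥ x) + v * (α + a ⬝ᵥ y) := by
    rw [dotProduct_add, dotProduct_smul, dotProduct_smul, smul_eq_mul, smul_eq_mul]
    linear_combination (-α) * huv
  rw [e]
  exact add_nonneg (mul_nonneg hu hx) (mul_nonneg hv hy)

/-- `cl(conv(V_ℝ(I))) ⊆ TH_k(I)`: the theta bodies are closed convex relaxations of the convex
hull of the real variety. [cite: BlekhermanParriloThomas2012, Ch. 7 §7.2, p. 297] -/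
theorem closure_convexHull_zeroLocus_subset_thetaBody :
    closure (convexHull ℝ (zeroLocus ℝ I)) ⊆ thetaBody I k :=
  closure_minimal (convexHull_min zeroLocus_subset_thetaBody convex_thetaBody)
    isClosed_thetaBody

/-- The elementary half of **Theorem 7.6** (`TH_k(I) = cl(Q_k(I))`), namely `Q_k(I) ⊆ TH_k(I)`:
if `L` is a linear functional on `ℝ[x]` vanishing on `I` (a functional on `ℝ[x]/I`) that is
nonnegative on the `k`-sos polynomials (`L ∈ Σᵏ(I)^*`) and has `L(1 + I) = 1`, then the point
`(L(x_1 + I), …, L(x_n + I))` lies in `TH_k(I)`: for `l = α + ⟨a, x⟩` `k`-sos mod `I` one has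
`l(L(x_1), …, L(x_n)) = L(l) = L(∑ h_j²) ≥ 0`.
[cite: BlekhermanParriloThomas2012, Ch. 7 §7.2.2, `Q_k(I)` and Theorem 7.6, pp. 304–305] -/
theorem mem_thetaBody_of_functional (L : MvPolynomial σ ℝ →ₗ[ℝ] ℝ)
    (hI : ∀ p ∈ I, L p = 0)
    (hpos : ∀ (m : ℕ) (h : Fin m → MvPolynomial σ ℝ), (∀ j, (h j).totalDegree ≤ k) →
      0 ≤ L (∑ j, h j ^ 2))
    (h1 : L 1 = 1) : (fun i => L (X i)) ∈ thetaBody I k := by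
  intro α a hl
  obtain ⟨m, h, hdeg, hmem⟩ := hl
  have h0 := hI _ hmem
  rw [map_sub, sub_eq_zero] at h0
  have e : L (affinePoly α a) = α + a ⬝ᵥ fun i => L (X i) := by
    simp only [affinePoly, map_add, map_sum, C_mul', map_smul, smul_eq_mul, dotProduct]
    rw [C_eq_smul_one, map_smul, h1, smul_eq_mul, mul_one]
  rw [← e, h0]
  exact hpos m h hdeg

/-- **Definition 7.25 (1)**: the theta body sequence of `I` *converges* to `cl(conv(V_ℝ(I)))`
if `⋂_k TH_k(I) = cl(conv(V_ℝ(I)))`.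
[cite: BlekhermanParriloThomas2012, Ch. 7 §7.3, Definition 7.25 (1)] -/
def ThetaConverges (I : Ideal (MvPolynomial σ ℝ)) : Prop :=
  ⋂ k, thetaBody I k = closure (convexHull ℝ (zeroLocus ℝ I))

/-- **Definition 7.25 (2)**: `I` is *`TH_k`-exact* if `TH_k(I) = cl(conv(V_ℝ(I)))`.
[cite: BlekhermanParriloThomas2012, Ch. 7 §7.3, Definition 7.25 (2)] -/
def IsThetaExact (I : Ideal (MvPolynomial σ ℝ)) (k : ℕ) : Prop :=
  thetaBody I k = closure (convexHull ℝ (zeroLocus ℝ I))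

/-- By the hierarchy `TH_k(I) ⊇ TH_l(I) ⊇ cl(conv(V_ℝ(I)))` (`k ≤ l`), `TH_k`-exactness
persists for all `l ≥ k`.
[cite: BlekhermanParriloThomas2012, Ch. 7 §7.2 p. 297 with §7.3 Definition 7.25 (2)] -/
theorem IsThetaExact.of_le {l : ℕ} (hk : IsThetaExact I k) (hkl : k ≤ l) :
    IsThetaExact I l :=
  Set.Subset.antisymm (hk ▸ thetaBody_antitone hkl)
    closure_convexHull_zeroLocus_subset_thetaBody

/-- A `TH_k`-exact ideal has a convergent theta body sequence.
[cite: BlekhermanParriloThomas2012, Ch. 7 §7.2 p. 297 with §7.3 Definition 7.25] -/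
theorem IsThetaExact.thetaConverges (hk : IsThetaExact I k) : ThetaConverges I :=
  Set.Subset.antisymm ((Set.iInter_subset _ k).trans hk.le)
    (Set.subset_iInter fun _ => closure_convexHull_zeroLocus_subset_thetaBody)

end ThetaBody

/-! ### Example 7.1: the lemniscate (pp. 299–301) -/

section Lemniscate

/-- `f(x, y) = x⁴ + y⁴ + 2x²y² − x² + y²`; its real zero set is the Bernoulli lemniscate with foci
`(±1/√2, 0)`. [cite: BlekhermanParriloThomas2012, Ch. 7 Example 7.1, p. 299] -/
def lemniscate : MvPolynomial (Fin 2) ℝ :=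
  X 0 ^ 4 + X 1 ^ 4 + 2 * X 0 ^ 2 * X 1 ^ 2 - X 0 ^ 2 + X 1 ^ 2

/-- `√8 = 2√2`. [folklore] -/
private theorem sqrt_eight : Real.sqrt 8 = 2 * Real.sqrt 2 := by
  rw [show (8 : ℝ) = 2 * 2 * 2 by norm_num, Real.sqrt_mul (by norm_num) 2,
    Real.sqrt_mul_self zero_le_two]

/-- `1/√8 = √2/4`. [folklore] -/
private theorem one_div_sqrt_eight : 1 / Real.sqrt 8 = Real.sqrt 2 / 4 := by
  rw [sqrt_eight, div_eq_div_iff (by positivity) (by norm_num), one_mul]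
  linear_combination (-2) * Real.mul_self_sqrt (zero_le_two (α := ℝ))

/-- The `2`-sos certificate of Example 7.1 with the constants written via `√2`
(`1/√8 = √2/4`, `1/√2 = √2/2`, `1/(4√2) = √2/8`):
`(√2/4 − y) = (√(√2/8)·(2x² + 2y² − 1))² + (√(√2)·(y − √2/4))² + (−√2/2)·f`. [folklore] -/
private theorem bitangent_eq :
    affinePoly (Real.sqrt 2 / 4) ![0, -1] =
      ∑ j : Fin 2, (![C (Real.sqrt (Real.sqrt 2 / 8)) * (C 2 * X 0 ^ 2 + C 2 * X 1 ^ 2 - C 1),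
          C (Real.sqrt (Real.sqrt 2)) * (X 1 - C (Real.sqrt 2 / 4))] j) ^ 2 +
        C (-(Real.sqrt 2 / 2)) * lemniscate := by
  apply MvPolynomial.funext
  intro x
  have hs : Real.sqrt 2 * Real.sqrt 2 = 2 := Real.mul_self_sqrt zero_le_two
  have hc1 : Real.sqrt (Real.sqrt 2 / 8) * Real.sqrt (Real.sqrt 2 / 8) = Real.sqrt 2 / 8 :=
    Real.mul_self_sqrt (by positivity)
  have hc2 : Real.sqrt (Real.sqrt 2) * Real.sqrt (Real.sqrt 2) = Real.sqrt 2 :=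
    Real.mul_self_sqrt (Real.sqrt_nonneg 2)
  simp only [eval_affinePoly, lemniscate, Fin.sum_univ_two, Matrix.cons_val_zero,
    Matrix.cons_val_one, map_add, map_sub, map_mul, map_pow, eval_C, eval_X, dotProduct,
    map_ofNat]
  linear_combination (x 1 / 2 - Real.sqrt 2 / 16) * hs
    - (2 * x 0 ^ 2 + 2 * x 1 ^ 2 - 1) ^ 2 * hc1 - (x 1 - Real.sqrt 2 / 4) ^ 2 * hc2

/-- **Example 7.1** (Reznick's exact certificate): the bitangent functional `l = 1/√8 − y` of
the lemniscate is `2`-sos mod `I = ⟨f⟩`, via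
`(1/√8 − y) + (1/√2)((x² + y²)² − (x² − y²)) = (1/(4√2))(2x² + 2y² − 1)² + √2 (y − 1/√8)²`.
[cite: BlekhermanParriloThomas2012, Ch. 7 Example 7.1, pp. 299–301] -/
theorem isKSosMod_two_bitangent :
    IsKSosMod (Ideal.span {lemniscate}) 2 (affinePoly (1 / Real.sqrt 8) ![0, -1]) := by
  rw [one_div_sqrt_eight]
  refine isKSosMod_of_eq _ (fun j => ?_)
    (Ideal.mul_mem_left _ _ (Ideal.subset_span rfl)) bitangent_eq
  have hc : ∀ (c : ℝ) (q : MvPolynomial (Fin 2) ℝ), (C c * q).totalDegree ≤ q.totalDegree :=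
    fun c q => (totalDegree_mul _ _).trans (by rw [totalDegree_C, zero_add])
  have hCX : ∀ (c : ℝ) (i : Fin 2),
      (C c * X i ^ 2 : MvPolynomial (Fin 2) ℝ).totalDegree ≤ 2 :=
    fun c i => (hc c _).trans (totalDegree_X_pow (R := ℝ) i 2).le
  fin_cases j
  · refine (hc _ _).trans ((totalDegree_sub _ _).trans (max_le ?_ ?_))
    · exact (totalDegree_add _ _).trans (max_le (hCX 2 0) (hCX 2 1))
    · rw [totalDegree_C]; exact Nat.zero_le _
  · refine (hc _ _).trans ((totalDegree_sub _ _).trans (max_le ?_ ?_))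
    · exact (totalDegree_X (R := ℝ) (1 : Fin 2)).le.trans one_le_two
    · rw [totalDegree_C]; exact Nat.zero_le _

/-- Hence `l = 1/√8 − y` is nonnegative on the lemniscate `V_ℝ(⟨f⟩)` ("the horizontal line
`y = 1/√8` is a bitangent … and `l` is nonnegative on `V_ℝ(I)`").
[cite: BlekhermanParriloThomas2012, Ch. 7 Example 7.1, p. 299] -/
theorem lemniscate_le_of_mem_zeroLocus {x : Fin 2 → ℝ}
    (hx : x ∈ zeroLocus ℝ (Ideal.span {lemniscate})) : x 1 ≤ 1 / Real.sqrt 8 := by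
  have h := isKSosMod_two_bitangent.eval_nonneg hx
  rw [eval_affinePoly] at h
  simp only [dotProduct, Fin.sum_univ_two, Matrix.cons_val_zero, Matrix.cons_val_one] at h
  linarith

/-- **Example 7.1**, consequence for the theta body: `TH₂(⟨f⟩)` lies in the closed half-plane
`y ≤ 1/√8` below the bitangent (the inequality `l ≥ 0` is valid on `TH₂(I)` because `l` is
`2`-sos mod `I`). [cite: BlekhermanParriloThomas2012, Ch. 7 Example 7.1, pp. 299–301, with
the definition of `TH_k`, p. 297] -/
theorem thetaBody_two_lemniscate_subset :
    thetaBody (Ideal.span {lemniscate}) 2 ⊆ {x | x 1 ≤ 1 / Real.sqrt 8} := by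
  intro x hx
  have h := hx _ _ isKSosMod_two_bitangent
  simp only [dotProduct, Fin.sum_univ_two, Matrix.cons_val_zero, Matrix.cons_val_one] at h
  simp only [Set.mem_setOf_eq]
  linarith

end Lemniscate

end Literature.Algebra.Polynomial.ThetaBodies
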